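import Mathlib.Topology.MetricSpace.ProperSpace
import Literature.Geometry.Lorentzian.Basic
import Literature.Geometry.Lorentzian.CoordScalarCurvatureEvolution
import HarnessLib

/-!
# Crux `GapExhaustion` (stmt-FinalStateConjecture-10808), line `photon-shell-pseudoconvexity`:
# stub (P-4) `stub_noncharStable` — `C¹`-stability of the non-characteristic datum

Route `BartnikGapSettling`; helper (`--supports stmt-FinalStateConjecture-10808`) landing the
registered sub-stub (P-4) of the `T`-conditional pseudo-convexity input (line lead c8): the
generic `C¹`-stability of the two bounds of Ionescu–Klainerman's non-characteristic condition
(Invent. Math. 175 (2009), Definition 3.1, (po3.2)) — a lower bound `g⁻¹(df, df) ≥ ν` and a bound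
`|D²f(∇f, ∇f)| ≤ B` on the Hessian in the gradient direction — under a `δ`-perturbation of the
`1`-jet `(G x, DG(x))` of the metric components at the point. Here `G₀` is a field of bilinear
forms, `C¹` near the compact set `S` and invertible on `S`, `f` is `C²` near `S`,
`Y = sharpAt G x (df_x) = (G x)⁻¹ df_x` is the `G`-gradient and `hessAt G f x` the coordinate
Hessian, so that BOTH quantities only depend (continuously near an invertible value) on the
`1`-jet of `G` at `x`.

Proof: for each `x ∈ S` the two jet functionals are continuous at `(x, 0)` in (point,
jet perturbation) space and take the values `≥ ν > ν / 2` and `≤ B < B + 1` (in absolute value)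
there, hence satisfy the relaxed bounds on a neighbourhood of `(x, 0)`; the generalised tube lemma
over the compact `S` gives a uniform `δ`.
-/

noncomputable section

-- instance search through the nested operator types `E4 →L[ℝ] E4 →L[ℝ] E4 →L[ℝ] ℝ`
set_option maxSynthPendingDepth 3

-- D-0017: single-problem summit, `Summit.<S>.<S>.…` by design (cf. lakefile `weak.linter.dupNamespace`).
set_option linter.dupNamespace false

namespace Summit.FinalStateConjecture.FinalStateConjecture.Theorems

open Set Filter
open Literature.Geometry.Lorentzian Literature.Geometry.Lorentzian.MetricCoord
open scoped Topology

/-- Generalised tube lemma: a property of `(z, p)` holding near `(z, 0)` for every `z` in a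
compact set `K` holds for all `z ∈ K` and all `‖p‖ ≤ δ`, for some uniform `δ > 0`. [folklore] -/
private theorem noncharStable_tube {X P : Type*} [TopologicalSpace X]
    [SeminormedAddCommGroup P] {K : Set X} (hK : IsCompact K) {good : X × P → Prop}
    (h : ∀ z ∈ K, ∀ᶠ q in 𝓝 (z, (0 : P)), good q) :
    ∃ δ : ℝ, 0 < δ ∧ ∀ z ∈ K, ∀ p : P, ‖p‖ ≤ δ → good (z, p) := by
  have hmem : {q | good q} ∈ (𝓝ˢ K) ×ˢ 𝓝 (0 : P) :=
    hK.mem_nhdsSet_prod_of_forall fun z hz => by rw [← nhds_prod_eq]; exact h z hz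
  obtain ⟨A, hA, B, hB, hAB⟩ := Filter.mem_prod_iff.1 hmem
  obtain ⟨ε, hε, hεB⟩ := Metric.mem_nhds_iff.1 hB
  refine ⟨ε / 2, half_pos hε, fun z hz p hp =>
    hAB (mk_mem_prod (subset_of_mem_nhdsSet hA hz) ?_)⟩
  exact hεB (mem_ball_zero_iff.2 (hp.trans_lt (half_lt_self hε)))

/-- The local step: at a point `x` of the open set `U` (where `G₀` is `C¹`, `f` is `C²` and
`G₀ x` is invertible) at which the strict bounds `ν / 2 < df(♯df)` and `|Hess f(♯df, ♯df)| < B + 1`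
hold, the relaxed bounds hold for the jet functionals at all nearby points and all small
perturbations `(p.2.1, p.2.2)` of the 1-jet `(G₀, DG₀)`. [folklore] -/
private theorem noncharStable_eventually
    {G₀ : E4 → E4 →L[ℝ] E4 →L[ℝ] ℝ} {f : E4 → ℝ} {U : Set E4} {ν B : ℝ} (hU : IsOpen U)
    (hG₀ : ContDiffOn ℝ 1 G₀ U) (hf : ContDiffOn ℝ 2 f U) {x : E4} (hx : x ∈ U)
    (hi : (G₀ x).IsInvertible)
    (hν : ν / 2 < fderiv ℝ f x (sharpAt G₀ x (fderiv ℝ f x)))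
    (hB : |hessAt G₀ f x (sharpAt G₀ x (fderiv ℝ f x)) (sharpAt G₀ x (fderiv ℝ f x))| < B + 1) :
    ∀ᶠ p in 𝓝 ((x, 0) :
        E4 × ((E4 →L[ℝ] E4 →L[ℝ] ℝ) × (E4 →L[ℝ] E4 →L[ℝ] E4 →L[ℝ] ℝ))),
      ν / 2 ≤ fderiv ℝ f p.1 ((G₀ p.1 + p.2.1).inverse (fderiv ℝ f p.1)) ∧
      |fderiv ℝ (fderiv ℝ f) p.1 ((G₀ p.1 + p.2.1).inverse (fderiv ℝ f p.1))
          ((G₀ p.1 + p.2.1).inverse (fderiv ℝ f p.1)) -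
        fderiv ℝ f p.1 ((2⁻¹ : ℝ) • (G₀ p.1 + p.2.1).inverse
          (koszulOp (fderiv ℝ G₀ p.1 + p.2.2) ((G₀ p.1 + p.2.1).inverse (fderiv ℝ f p.1))
            ((G₀ p.1 + p.2.1).inverse (fderiv ℝ f p.1))))| ≤ B + 1 := by
  have hxU : U ∈ 𝓝 x := hU.mem_nhds hx
  -- continuity of the jets of `G₀` and `f` at `x`
  have hcG : ContinuousAt G₀ x := hG₀.continuousOn.continuousAt hxU
  have hcdG : ContinuousAt (fderiv ℝ G₀) x :=
    (hG₀.continuousOn_fderiv_of_isOpen hU le_rfl).continuousAt hxU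
  have hcdf : ContinuousAt (fderiv ℝ f) x :=
    (hf.continuousOn_fderiv_of_isOpen hU (by norm_num)).continuousAt hxU
  have hcddf : ContinuousAt (fderiv ℝ (fderiv ℝ f)) x :=
    ((hf.fderiv_of_isOpen hU (m := 1) (by norm_num)).continuousOn_fderiv_of_isOpen hU
      le_rfl).continuousAt hxU
  -- the coordinate projections of the parameter space
  have h1 : Continuous fun p :
      E4 × ((E4 →L[ℝ] E4 →L[ℝ] ℝ) × (E4 →L[ℝ] E4 →L[ℝ] E4 →L[ℝ] ℝ)) => p.1 :=
    continuous_fst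
  have h21 : Continuous fun p :
      E4 × ((E4 →L[ℝ] E4 →L[ℝ] ℝ) × (E4 →L[ℝ] E4 →L[ℝ] E4 →L[ℝ] ℝ)) => p.2.1 :=
    continuous_fst.comp continuous_snd
  have h22 : Continuous fun p :
      E4 × ((E4 →L[ℝ] E4 →L[ℝ] ℝ) × (E4 →L[ℝ] E4 →L[ℝ] E4 →L[ℝ] ℝ)) => p.2.2 :=
    continuous_snd.comp continuous_snd
  -- continuity of the pieces of the two jet functionals at `p₀ = (x, 0)`
  have hGc : ContinuousAt (fun p :
      E4 × ((E4 →L[ℝ] E4 →L[ℝ] ℝ) × (E4 →L[ℝ] E4 →L[ℝ] E4 →L[ℝ] ℝ)) =>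
      G₀ p.1 + p.2.1) (x, 0) :=
    (hcG.comp h1.continuousAt).add h21.continuousAt
  have hdf : ContinuousAt (fun p :
      E4 × ((E4 →L[ℝ] E4 →L[ℝ] ℝ) × (E4 →L[ℝ] E4 →L[ℝ] E4 →L[ℝ] ℝ)) =>
      fderiv ℝ f p.1) (x, 0) :=
    hcdf.comp h1.continuousAt
  have hddf : ContinuousAt (fun p :
      E4 × ((E4 →L[ℝ] E4 →L[ℝ] ℝ) × (E4 →L[ℝ] E4 →L[ℝ] E4 →L[ℝ] ℝ)) =>
      fderiv ℝ (fderiv ℝ f) p.1) (x, 0) :=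
    hcddf.comp h1.continuousAt
  have hD : ContinuousAt (fun p :
      E4 × ((E4 →L[ℝ] E4 →L[ℝ] ℝ) × (E4 →L[ℝ] E4 →L[ℝ] E4 →L[ℝ] ℝ)) =>
      (G₀ p.1 + p.2.1).inverse) (x, 0) := by
    refine ContinuousAt.comp_of_eq (hi.contDiffAt_map_inverse (n := 0)).continuousAt hGc ?_
    simp
  have hY : ContinuousAt (fun p :
      E4 × ((E4 →L[ℝ] E4 →L[ℝ] ℝ) × (E4 →L[ℝ] E4 →L[ℝ] E4 →L[ℝ] ℝ)) =>
      (G₀ p.1 + p.2.1).inverse (fderiv ℝ f p.1)) (x, 0) :=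
    hD.clm_apply hdf
  have hA : ContinuousAt (fun p :
      E4 × ((E4 →L[ℝ] E4 →L[ℝ] ℝ) × (E4 →L[ℝ] E4 →L[ℝ] E4 →L[ℝ] ℝ)) =>
      fderiv ℝ f p.1 ((G₀ p.1 + p.2.1).inverse (fderiv ℝ f p.1))) (x, 0) :=
    hdf.clm_apply hY
  have hE : ContinuousAt (fun p :
      E4 × ((E4 →L[ℝ] E4 →L[ℝ] ℝ) × (E4 →L[ℝ] E4 →L[ℝ] E4 →L[ℝ] ℝ)) =>
      koszulOp (fderiv ℝ G₀ p.1 + p.2.2) ((G₀ p.1 + p.2.1).inverse (fderiv ℝ f p.1))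
        ((G₀ p.1 + p.2.1).inverse (fderiv ℝ f p.1))) (x, 0) :=
    ((koszulOp.continuous.continuousAt.comp
      ((hcdG.comp h1.continuousAt).add h22.continuousAt)).clm_apply hY).clm_apply hY
  have hH : ContinuousAt (fun p :
      E4 × ((E4 →L[ℝ] E4 →L[ℝ] ℝ) × (E4 →L[ℝ] E4 →L[ℝ] E4 →L[ℝ] ℝ)) =>
      |fderiv ℝ (fderiv ℝ f) p.1 ((G₀ p.1 + p.2.1).inverse (fderiv ℝ f p.1))
          ((G₀ p.1 + p.2.1).inverse (fderiv ℝ f p.1)) -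
        fderiv ℝ f p.1 ((2⁻¹ : ℝ) • (G₀ p.1 + p.2.1).inverse
          (koszulOp (fderiv ℝ G₀ p.1 + p.2.2) ((G₀ p.1 + p.2.1).inverse (fderiv ℝ f p.1))
            ((G₀ p.1 + p.2.1).inverse (fderiv ℝ f p.1))))|) (x, 0) :=
    (((hddf.clm_apply hY).clm_apply hY).sub
      (hdf.clm_apply ((hD.clm_apply hE).const_smul (2⁻¹ : ℝ)))).abs
  -- the strict bounds at `p₀`
  have hν' : ν / 2 < fderiv ℝ f x ((G₀ x + 0).inverse (fderiv ℝ f x)) := by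
    rw [add_zero]
    exact hν
  have hB' : |fderiv ℝ (fderiv ℝ f) x ((G₀ x + 0).inverse (fderiv ℝ f x))
          ((G₀ x + 0).inverse (fderiv ℝ f x)) -
        fderiv ℝ f x ((2⁻¹ : ℝ) • (G₀ x + 0).inverse
          (koszulOp (fderiv ℝ G₀ x + 0) ((G₀ x + 0).inverse (fderiv ℝ f x))
            ((G₀ x + 0).inverse (fderiv ℝ f x))))| < B + 1 := by
    rw [add_zero, add_zero]
    rwa [hessAt_apply, chrAt_apply] at hB
  filter_upwards [continuousAt_const.eventually_lt hA hν', hH.eventually_lt continuousAt_const hB']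
    with p hp1 hp2 using ⟨hp1.le, hp2.le⟩

/-- **Stub (P-4) of the `T`-conditional pseudo-convexity input (line
`photon-shell-pseudoconvexity`, crux `GapExhaustion`, stmt-FinalStateConjecture-10808) —
`C¹`-stability of the non-characteristic datum.**
Let `G₀` be `C¹` and `f` be `C²` on an open neighbourhood of the compact set `S ⊆ E4`, with `G₀ x`
invertible on `S`, and suppose that for all `x ∈ S` the `G₀`-gradient `Y₀ = ♯df` of `f` satisfies
`df(Y₀) ≥ ν > 0` and `|Hess_{G₀} f (Y₀, Y₀)| ≤ B`. Then there is `δ > 0` such that for every `x ∈ S`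
and every field of components `G` with `‖G x - G₀ x‖ ≤ δ` and `‖DG(x) - DG₀(x)‖ ≤ δ`, the
`G`-gradient `Y = ♯df` satisfies `df(Y) ≥ ν / 2` and `|Hess_G f (Y, Y)| ≤ B + 1`
(Ionescu–Klainerman's non-characteristic condition, Invent. Math. 175 (2009), Def. 3.1 (po3.2),
is open in the `C¹`-jet of `g`). Compactness of `S` and continuity of the two jet functionals.
[folklore] -/
theorem stub_noncharStable :
    ∀ (G₀ : E4 → E4 →L[ℝ] E4 →L[ℝ] ℝ) (f : E4 → ℝ) (S : Set E4) (ν B : ℝ),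
      IsCompact S → 0 < ν →
      (∃ U : Set E4, IsOpen U ∧ S ⊆ U ∧ ContDiffOn ℝ 1 G₀ U ∧ ContDiffOn ℝ 2 f U) →
      (∀ x ∈ S, (G₀ x).IsInvertible) →
      (∀ x ∈ S, ν ≤ fderiv ℝ f x (sharpAt G₀ x (fderiv ℝ f x)) ∧
        |hessAt G₀ f x (sharpAt G₀ x (fderiv ℝ f x)) (sharpAt G₀ x (fderiv ℝ f x))| ≤ B) →
      ∃ δ : ℝ, 0 < δ ∧ ∀ x ∈ S, ∀ (G : E4 → E4 →L[ℝ] E4 →L[ℝ] ℝ),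
        ‖G x - G₀ x‖ ≤ δ → ‖fderiv ℝ G x - fderiv ℝ G₀ x‖ ≤ δ →
        ν / 2 ≤ fderiv ℝ f x (sharpAt G x (fderiv ℝ f x)) ∧
        |hessAt G f x (sharpAt G x (fderiv ℝ f x)) (sharpAt G x (fderiv ℝ f x))| ≤ B + 1 := by
  intro G₀ f S ν B hS hν hU hinv hbd
  obtain ⟨U, hU, hSU, hG₀, hf⟩ := hU
  -- the relaxed bounds hold near `(x, 0)` for every `x ∈ S`
  have hnhds : ∀ x ∈ S, ∀ᶠ p in 𝓝 ((x, 0) :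
        E4 × ((E4 →L[ℝ] E4 →L[ℝ] ℝ) × (E4 →L[ℝ] E4 →L[ℝ] E4 →L[ℝ] ℝ))),
      ν / 2 ≤ fderiv ℝ f p.1 ((G₀ p.1 + p.2.1).inverse (fderiv ℝ f p.1)) ∧
      |fderiv ℝ (fderiv ℝ f) p.1 ((G₀ p.1 + p.2.1).inverse (fderiv ℝ f p.1))
          ((G₀ p.1 + p.2.1).inverse (fderiv ℝ f p.1)) -
        fderiv ℝ f p.1 ((2⁻¹ : ℝ) • (G₀ p.1 + p.2.1).inverse
          (koszulOp (fderiv ℝ G₀ p.1 + p.2.2) ((G₀ p.1 + p.2.1).inverse (fderiv ℝ f p.1))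
            ((G₀ p.1 + p.2.1).inverse (fderiv ℝ f p.1))))| ≤ B + 1 := by
    intro x hx
    obtain ⟨h1, h2⟩ := hbd x hx
    exact noncharStable_eventually hU hG₀ hf (hSU hx) (hinv x hx) (by linarith) (by linarith)
  obtain ⟨δ, hδ, hgood⟩ := noncharStable_tube hS hnhds
  refine ⟨δ, hδ, fun x hx G hG hdG => ?_⟩
  -- apply the tube at the perturbation `(G x - G₀ x, DG(x) - DG₀(x))`
  have key : ν / 2 ≤ fderiv ℝ f x ((G₀ x + (G x - G₀ x)).inverse (fderiv ℝ f x)) ∧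
      |fderiv ℝ (fderiv ℝ f) x ((G₀ x + (G x - G₀ x)).inverse (fderiv ℝ f x))
          ((G₀ x + (G x - G₀ x)).inverse (fderiv ℝ f x)) -
        fderiv ℝ f x ((2⁻¹ : ℝ) • (G₀ x + (G x - G₀ x)).inverse
          (koszulOp (fderiv ℝ G₀ x + (fderiv ℝ G x - fderiv ℝ G₀ x))
            ((G₀ x + (G x - G₀ x)).inverse (fderiv ℝ f x))
            ((G₀ x + (G x - G₀ x)).inverse (fderiv ℝ f x))))| ≤ B + 1 :=
    hgood x hx (G x - G₀ x, fderiv ℝ G x - fderiv ℝ G₀ x) (max_le hG hdG)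
  rw [add_sub_cancel, add_sub_cancel] at key
  rw [hessAt_apply, chrAt_apply]
  exact key

end Summit.FinalStateConjecture.FinalStateConjecture.Theorems

end
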